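import Literature.NumberTheory.Sieve.SmoothZetaComplex
import Literature.NumberTheory.Sieve.SmoothSaddlePointPhi
import Mathlib.Analysis.SpecialFunctions.Complex.LogDeriv
import Mathlib.Analysis.SpecialFunctions.Pow.Deriv
import HarnessLib

/-!
# `log ζ(s, y)` and its derivatives `φ₁, φ₂` at complex `s`

(Module docstring completed once the file is stable.)
-/

noncomputable section

open Complex Finset

namespace Literature.NumberTheory.Sieve

variable {σ t : ℝ} {y p : ℕ} {s : ℂ}

/-! ### Definitions -/

/-- `φ(s, y) = log ζ(s, y) = -Σ_{p ≤ y} Log(1 - p^{-s})` (principal logarithms; each `1 - p^{-s}` has positive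
real part for `Re s > 0`), Hildebrand–Tenenbaum's `φ(s, y)`. [cite: HildebrandTenenbaum1986, §2 (definition of φ)] -/
def smoothLogZeta (s : ℂ) (y : ℕ) : ℂ :=
  -∑ p ∈ Nat.primesLE y, Complex.log (1 - (p : ℂ) ^ (-s))

/-- `-φ₁(s, y) = Σ_{p ≤ y} log p/(p^s - 1)` at complex `s` (the complex extension of `saddleSum`).
[cite: HildebrandTenenbaum1986, §2 (definition of φ_k)] -/
def smoothPhi₁ (s : ℂ) (y : ℕ) : ℂ :=
  ∑ p ∈ Nat.primesLE y, (Real.log p : ℂ) / ((p : ℂ) ^ s - 1)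

/-- `φ₂(s, y) = Σ_{p ≤ y} log² p · p^s/(p^s - 1)²` at complex `s` (the complex extension of `saddlePhi₂`).
[cite: HildebrandTenenbaum1986, §2 (definition of φ_k)] -/
def smoothPhi₂ (s : ℂ) (y : ℕ) : ℂ :=
  ∑ p ∈ Nat.primesLE y, (Real.log p : ℂ) ^ 2 * ((p : ℂ) ^ s / ((p : ℂ) ^ s - 1) ^ 2)

/-! ### Basic facts about the Euler factors -/

/-- Members of `primesLE y` are at least `2`. [folklore] -/
private theorem two_le_of_mem₃ (hp : p ∈ Nat.primesLE y) : 2 ≤ p := (Nat.mem_primesLE.1 hp).2.two_le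

/-- `Re(1 - p^{-s}) > 0` for `p ≥ 2`, `Re s > 0`; in particular `1 - p^{-s}` lies in the slit plane.
[folklore] -/
theorem one_sub_cpow_re_pos (hp : 2 ≤ p) (hs : 0 < s.re) : 0 < (1 - (p : ℂ) ^ (-s)).re := by
  have hnorm : ‖(p : ℂ) ^ (-s)‖ < 1 := by
    rw [norm_natCast_cpow_neg (by omega) s]
    have hp1 : (1 : ℝ) < p := by exact_mod_cast (lt_of_lt_of_le one_lt_two hp)
    exact Real.rpow_lt_one_of_one_lt_of_neg hp1 (by linarith)
  have hre : ((p : ℂ) ^ (-s)).re ≤ ‖(p : ℂ) ^ (-s)‖ := Complex.re_le_norm _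
  simp only [Complex.sub_re, Complex.one_re]
  linarith

/-- `1 - p^{-s} ∈ slitPlane` for `p ≥ 2`, `Re s > 0`. [folklore] -/
theorem one_sub_cpow_mem_slitPlane (hp : 2 ≤ p) (hs : 0 < s.re) :
    1 - (p : ℂ) ^ (-s) ∈ Complex.slitPlane :=
  Complex.mem_slitPlane_iff.2 (Or.inl (one_sub_cpow_re_pos hp hs))

/-- `p^s ≠ 1` for `p ≥ 2`, `Re s > 0` (as `‖p^s‖ = p^{Re s} > 1`). [folklore] -/
theorem cpow_ne_one (hp : 2 ≤ p) (hs : 0 < s.re) : (p : ℂ) ^ s ≠ 1 := by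
  intro h
  have : ‖(p : ℂ) ^ s‖ = 1 := by rw [h]; simp
  rw [Complex.norm_natCast_cpow_of_pos (by omega)] at this
  have hp1 : (1 : ℝ) < p := by exact_mod_cast (lt_of_lt_of_le one_lt_two hp)
  have : 1 < (p : ℝ) ^ s.re := Real.one_lt_rpow hp1 hs
  linarith

/-- `p^s - 1 ≠ 0` for `p ≥ 2`, `Re s > 0`. [folklore] -/
theorem cpow_sub_one_ne_zero (hp : 2 ≤ p) (hs : 0 < s.re) : (p : ℂ) ^ s - 1 ≠ 0 :=
  sub_ne_zero.2 (cpow_ne_one hp hs)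

/-- `p^{-s} = (p^s)⁻¹`. [folklore] -/
theorem natCast_cpow_neg_eq_inv (p : ℕ) (s : ℂ) : (p : ℂ) ^ (-s) = ((p : ℂ) ^ s)⁻¹ :=
  Complex.cpow_neg _ _

/-! ### `exp φ = ζ` and real points -/

/-- **`exp φ(s, y) = ζ(s, y)`** for `Re s > 0`. [cite: HildebrandTenenbaum1986, §2 (definition of φ)] -/
theorem exp_smoothLogZeta (hs : 0 < s.re) (y : ℕ) : Complex.exp (smoothLogZeta s y) = smoothZetaC s y := by
  rw [smoothLogZeta, ← Finset.sum_neg_distrib, Complex.exp_sum, smoothZetaC]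
  refine Finset.prod_congr rfl fun p hp => ?_
  rw [Complex.exp_neg, Complex.exp_log (one_sub_cpow_ne_zero (two_le_of_mem₃ hp) hs)]

/-- At a real point `σ > 0`, `φ(σ, y) = log ζ(σ, y)` (real logarithm of the tree's `smoothZeta`).
[folklore] -/
theorem smoothLogZeta_ofReal (hσ : 0 < σ) (y : ℕ) :
    smoothLogZeta σ y = (Real.log (smoothZeta σ y) : ℂ) := by
  rw [smoothLogZeta, log_smoothZeta hσ]
  push_cast
  rw [← Finset.sum_neg_distrib]
  refine Finset.sum_congr rfl fun p hp => ?_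
  have hp2 := two_le_of_mem₃ hp
  have hp0 : (0 : ℝ) ≤ p := Nat.cast_nonneg _
  have hp1 : (1 : ℝ) < p := by exact_mod_cast (lt_of_lt_of_le one_lt_two hp2)
  have hlt : (p : ℝ) ^ (-σ) < 1 := Real.rpow_lt_one_of_one_lt_of_neg hp1 (by linarith)
  have hcast : (1 : ℂ) - (p : ℂ) ^ (-(σ : ℂ)) = (((1 - (p : ℝ) ^ (-σ) : ℝ)) : ℂ) := by
    push_cast
    rw [show (p : ℂ) = ((p : ℝ) : ℂ) by simp, ← Complex.ofReal_neg, ← Complex.ofReal_cpow hp0 (-σ)]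
  rw [hcast, ← Complex.ofReal_log (by linarith)]

/-- At a real point, `-φ₁(σ, y)` is the tree's `saddleSum σ y`. [folklore] -/
theorem smoothPhi₁_ofReal (σ : ℝ) (y : ℕ) : smoothPhi₁ σ y = (saddleSum σ y : ℂ) := by
  rw [smoothPhi₁, saddleSum]
  push_cast
  refine Finset.sum_congr rfl fun p hp => ?_
  have hp0 : (0 : ℝ) ≤ p := Nat.cast_nonneg _
  rw [show (p : ℂ) = ((p : ℝ) : ℂ) by simp, ← Complex.ofReal_cpow hp0 σ]

/-- At a real point, `φ₂(σ, y)` is the tree's `saddlePhi₂ σ y`. [folklore] -/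
theorem smoothPhi₂_ofReal (σ : ℝ) (y : ℕ) : smoothPhi₂ σ y = (saddlePhi₂ σ y : ℂ) := by
  rw [smoothPhi₂, saddlePhi₂]
  push_cast
  refine Finset.sum_congr rfl fun p hp => ?_
  have hp0 : (0 : ℝ) ≤ p := Nat.cast_nonneg _
  rw [show (p : ℂ) = ((p : ℝ) : ℂ) by simp, ← Complex.ofReal_cpow hp0 σ]

/-! ### Derivatives -/

/-- `(d/ds) p^{-s} = -log p · p^{-s}` (`p ≥ 1`). [folklore] -/
theorem hasDerivAt_natCast_cpow_neg (hp : 0 < p) (s : ℂ) :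
    HasDerivAt (fun z : ℂ => (p : ℂ) ^ (-z)) (-(Real.log p : ℂ) * (p : ℂ) ^ (-s)) s := by
  have hpC : (p : ℂ) ≠ 0 := by exact_mod_cast hp.ne'
  have h := (hasDerivAt_neg s).const_cpow (c := (p : ℂ)) (Or.inl hpC)
  have hlog : Complex.log (p : ℂ) = (Real.log p : ℂ) := by
    rw [show (p : ℂ) = ((p : ℝ) : ℂ) by simp, ← Complex.ofReal_log (Nat.cast_nonneg _)]
  rw [hlog] at h
  refine h.congr_deriv ?_
  ring

/-- `(d/ds) p^{s} = log p · p^{s}` (`p ≥ 1`). [folklore] -/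
theorem hasDerivAt_natCast_cpow (hp : 0 < p) (s : ℂ) :
    HasDerivAt (fun z : ℂ => (p : ℂ) ^ z) ((Real.log p : ℂ) * (p : ℂ) ^ s) s := by
  have hpC : (p : ℂ) ≠ 0 := by exact_mod_cast hp.ne'
  have h := (hasDerivAt_id s).const_cpow (c := (p : ℂ)) (Or.inl hpC)
  have hlog : Complex.log (p : ℂ) = (Real.log p : ℂ) := by
    rw [show (p : ℂ) = ((p : ℝ) : ℂ) by simp, ← Complex.ofReal_log (Nat.cast_nonneg _)]
  rw [hlog] at h
  simp only [id] at h
  refine h.congr_deriv ?_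
  ring

/-- **`φ'(s, y) = φ₁(s, y) = -Σ_p log p/(p^s - 1)`** (`Re s > 0`).
[cite: HildebrandTenenbaum1986, §2 (definition of φ_k)] -/
theorem hasDerivAt_smoothLogZeta (hs : 0 < s.re) (y : ℕ) :
    HasDerivAt (fun z : ℂ => smoothLogZeta z y) (-smoothPhi₁ s y) s := by
  have hterm : ∀ p ∈ Nat.primesLE y, HasDerivAt (fun z : ℂ => Complex.log (1 - (p : ℂ) ^ (-z)))
      ((Real.log p : ℂ) / ((p : ℂ) ^ s - 1)) s := by
    intro p hp
    have hp2 := two_le_of_mem₃ hp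
    have hp0 : 0 < p := by omega
    have h1 : HasDerivAt (fun z : ℂ => 1 - (p : ℂ) ^ (-z))
        (0 - (-(Real.log p : ℂ) * (p : ℂ) ^ (-s))) s :=
      (hasDerivAt_const s (1 : ℂ)).sub (hasDerivAt_natCast_cpow_neg hp0 s)
    have h2 := h1.clog (one_sub_cpow_mem_slitPlane hp2 hs)
    refine h2.congr_deriv ?_
    have hne := cpow_sub_one_ne_zero hp2 hs
    have hne' : (1 : ℂ) - (p : ℂ) ^ (-s) ≠ 0 := one_sub_cpow_ne_zero hp2 hs
    have hpC : (p : ℂ) ≠ 0 := by exact_mod_cast hp0.ne'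
    have hps : (p : ℂ) ^ s ≠ 0 := fun h => hpC ((Complex.cpow_eq_zero_iff _ _).1 h).1
    rw [natCast_cpow_neg_eq_inv] at hne' ⊢
    field_simp
    ring
  have h := (HasDerivAt.fun_sum hterm).fun_neg
  exact h


/-- **`φ₁'(s, y) = φ₂(s, y)`**, i.e. `(d/ds) Σ_p log p/(p^s - 1) = -Σ_p log² p · p^s/(p^s - 1)²` (`Re s > 0`).
[cite: HildebrandTenenbaum1986, §2 (definition of φ_k)] -/
theorem hasDerivAt_smoothPhi₁ (hs : 0 < s.re) (y : ℕ) :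
    HasDerivAt (fun z : ℂ => smoothPhi₁ z y) (-smoothPhi₂ s y) s := by
  have hterm : ∀ p ∈ Nat.primesLE y, HasDerivAt (fun z : ℂ => (Real.log p : ℂ) / ((p : ℂ) ^ z - 1))
      (-((Real.log p : ℂ) ^ 2 * ((p : ℂ) ^ s / ((p : ℂ) ^ s - 1) ^ 2))) s := by
    intro p hp
    have hp2 := two_le_of_mem₃ hp
    have hp0 : 0 < p := by omega
    have hne := cpow_sub_one_ne_zero hp2 hs
    have h1 : HasDerivAt (fun z : ℂ => (p : ℂ) ^ z - 1) ((Real.log p : ℂ) * (p : ℂ) ^ s) s :=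
      (hasDerivAt_natCast_cpow hp0 s).sub_const 1
    have h2 := (h1.inv hne).const_mul (Real.log p : ℂ)
    have h3 : HasDerivAt (fun z : ℂ => (Real.log p : ℂ) / ((p : ℂ) ^ z - 1))
        ((Real.log p : ℂ) * (-((Real.log p : ℂ) * (p : ℂ) ^ s) / ((p : ℂ) ^ s - 1) ^ 2)) s := by
      refine h2.congr_of_eventuallyEq (Filter.Eventually.of_forall fun z => ?_)
      simp [div_eq_mul_inv]
    refine h3.congr_deriv ?_
    field_simp
  exact (HasDerivAt.fun_sum hterm).congr_deriv (by rw [Finset.sum_neg_distrib, smoothPhi₂])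

/-! ### `φ₂` near the real axis -/

/-- `‖e^{iu} - 1‖ ≤ |u|`. [folklore] -/
theorem norm_exp_mul_I_sub_one_le (u : ℝ) : ‖Complex.exp (u * I) - 1‖ ≤ |u| := by
  have hsq : ‖Complex.exp (u * I) - 1‖ ^ 2 = 2 - 2 * Real.cos u := by
    rw [Complex.exp_mul_I, Complex.sq_norm, Complex.normSq_apply, ← Complex.ofReal_cos,
      ← Complex.ofReal_sin]
    simp only [Complex.sub_re, Complex.one_re, Complex.add_re, Complex.ofReal_re, Complex.mul_re,
      Complex.I_re, Complex.ofReal_im, Complex.I_im, Complex.sub_im, Complex.one_im,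
      Complex.add_im, Complex.mul_im]
    have := Real.sin_sq_add_cos_sq u
    nlinarith
  have hcos : 1 - Real.cos u ≤ u ^ 2 / 2 := by linarith [Real.one_sub_sq_div_two_le_cos (x := u)]
  have h2 : ‖Complex.exp (u * I) - 1‖ ^ 2 ≤ |u| ^ 2 := by rw [hsq, sq_abs]; linarith
  exact (pow_le_pow_iff_left₀ (norm_nonneg _) (abs_nonneg _) two_ne_zero).1 h2

/-- `p^{σ+it} = p^σ e^{it log p}` for `p ≥ 1`. [folklore] -/
theorem natCast_cpow_add_mul_I (hp : 0 < p) (σ t : ℝ) :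
    (p : ℂ) ^ ((σ : ℂ) + t * I) = (((p : ℝ) ^ σ : ℝ) : ℂ) * Complex.exp ((t * Real.log p : ℝ) * I) := by
  have hp0 : (0 : ℝ) < p := by exact_mod_cast hp
  have hpC : (p : ℂ) ≠ 0 := by exact_mod_cast hp.ne'
  rw [Complex.cpow_add _ _ hpC, show (p : ℂ) = ((p : ℝ) : ℂ) by simp, ← Complex.ofReal_cpow hp0.le σ]
  congr 1
  rw [Complex.cpow_def_of_ne_zero (by exact_mod_cast hp0.ne'), ← Complex.ofReal_log hp0.le]
  congr 1
  push_cast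
  ring

/-- The algebraic identity behind the Lipschitz bound for `v ↦ v/(v-1)²`:
`a/(a-1)² - w/(w-1)² = (w - a)(a w - 1)/((a-1)²(w-1)²)`. [folklore] -/
theorem div_sq_sub_div_sq_eq {a w : ℂ} (ha : a - 1 ≠ 0) (hw : w - 1 ≠ 0) :
    a / (a - 1) ^ 2 - w / (w - 1) ^ 2 = (w - a) * (a * w - 1) / ((a - 1) ^ 2 * (w - 1) ^ 2) := by
  field_simp
  ring

/-- **`φ₂` is Lipschitz off the real axis**: for `σ ≥ 3/5`,
`‖φ₂(σ + it, y) - φ₂(σ, y)‖ ≤ 13 |t| log y · φ₂(σ, y)` (termwise, with `a = p^σ ≥ 3/2` and `w = p^{σ+it}`,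
`|a/(a-1)² - w/(w-1)²| ≤ a|t| log p · (a²+1)/(a-1)⁴ ≤ 13 |t| log p · a/(a-1)²`). [folklore] -/
theorem norm_smoothPhi₂_sub_le (hσ : 3 / 5 ≤ σ) (t : ℝ) (y : ℕ) :
    ‖smoothPhi₂ ((σ : ℂ) + t * I) y - smoothPhi₂ σ y‖ ≤ 13 * |t| * Real.log y * saddlePhi₂ σ y := by
  have hσ0 : 0 < σ := by linarith
  rw [smoothPhi₂, smoothPhi₂, ← Finset.sum_sub_distrib, saddlePhi₂, Finset.mul_sum]
  refine (norm_sum_le _ _).trans (Finset.sum_le_sum fun p hp => ?_)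
  obtain ⟨hpy, hpp⟩ := Nat.mem_primesLE.1 hp
  have hp2 := hpp.two_le
  have hp0 : 0 < p := by omega
  have hp2r : (2 : ℝ) ≤ p := by exact_mod_cast hp2
  have hp0r : (0 : ℝ) < p := by linarith
  have hlogp0 : 0 ≤ Real.log p := Real.log_nonneg (by linarith)
  have hlogpy : Real.log p ≤ Real.log y := Real.log_le_log hp0r (by exact_mod_cast hpy)
  -- `a = p^σ ≥ 3/2`, `w = p^{σ+it}`, `‖w‖ = a`
  set a : ℝ := (p : ℝ) ^ σ with ha
  have ha32 : (3 / 2 : ℝ) ≤ a := by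
    calc (3 / 2 : ℝ) ≤ (2 : ℝ) ^ (3 / 5 : ℝ) := three_halves_le_two_rpow
      _ ≤ (2 : ℝ) ^ σ := Real.rpow_le_rpow_of_exponent_le one_le_two hσ
      _ ≤ (p : ℝ) ^ σ := Real.rpow_le_rpow (by norm_num) hp2r hσ0.le
  have ha1 : 0 < a - 1 := by linarith
  set w : ℂ := (p : ℂ) ^ ((σ : ℂ) + t * I) with hw
  have hwa : w = (a : ℂ) * Complex.exp ((t * Real.log p : ℝ) * I) := by
    rw [hw, natCast_cpow_add_mul_I hp0 σ t, ha]
  have hnormw : ‖w‖ = a := by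
    rw [hwa, norm_mul, Complex.norm_exp_ofReal_mul_I, mul_one, Complex.norm_real, Real.norm_eq_abs,
      abs_of_pos (by linarith)]
  have haC : ((p : ℂ) ^ (σ : ℂ)) = (a : ℂ) := by
    rw [ha, show (p : ℂ) = ((p : ℝ) : ℂ) by simp, ← Complex.ofReal_cpow hp0r.le σ]
  -- the two denominators
  have ha1C : (a : ℂ) - 1 ≠ 0 := by
    intro h
    have := congrArg Complex.re h
    simp at this
    linarith
  have hsC : 0 < ((σ : ℂ) + t * I).re := by simpa using hσ0
  have hw1 : w - 1 ≠ 0 := cpow_sub_one_ne_zero hp2 hsC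
  have hw1_norm : a - 1 ≤ ‖w - 1‖ := by
    have := norm_sub_norm_le w 1
    rw [hnormw, norm_one] at this
    linarith [abs_sub_abs_le_abs_sub ‖w‖ ‖(1 : ℂ)‖, norm_sub_rev w 1]
  -- the difference of the `p`-terms
  have hdiff : (Real.log p : ℂ) ^ 2 * ((p : ℂ) ^ ((σ : ℂ) + t * I) / ((p : ℂ) ^ ((σ : ℂ) + t * I) - 1) ^ 2) -
      (Real.log p : ℂ) ^ 2 * ((p : ℂ) ^ (σ : ℂ) / ((p : ℂ) ^ (σ : ℂ) - 1) ^ 2) =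
      -((Real.log p : ℂ) ^ 2 * ((w - a) * (a * w - 1) / (((a : ℂ) - 1) ^ 2 * (w - 1) ^ 2))) := by
    rw [← hw, haC, ← div_sq_sub_div_sq_eq ha1C hw1]
    ring
  rw [hdiff, norm_neg, norm_mul, norm_pow, Complex.norm_real, Real.norm_eq_abs, abs_of_nonneg hlogp0]
  -- `‖(w - a)(aw - 1)/((a-1)²(w-1)²)‖ ≤ a|t| log p (a²+1)/(a-1)⁴`
  have hwa_norm : ‖w - a‖ ≤ a * (|t| * Real.log p) := by
    rw [hwa, show (a : ℂ) * Complex.exp ((t * Real.log p : ℝ) * I) - a =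
      (a : ℂ) * (Complex.exp ((t * Real.log p : ℝ) * I) - 1) by ring, norm_mul, Complex.norm_real,
      Real.norm_eq_abs, abs_of_pos (by linarith)]
    refine mul_le_mul_of_nonneg_left ?_ (by linarith)
    calc ‖Complex.exp ((t * Real.log p : ℝ) * I) - 1‖ ≤ |t * Real.log p| := norm_exp_mul_I_sub_one_le _
      _ = |t| * Real.log p := by rw [abs_mul, abs_of_nonneg hlogp0]
  have haw_norm : ‖(a : ℂ) * w - 1‖ ≤ a ^ 2 + 1 := by
    calc ‖(a : ℂ) * w - 1‖ ≤ ‖(a : ℂ) * w‖ + ‖(1 : ℂ)‖ := norm_sub_le _ _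
      _ = a ^ 2 + 1 := by
          rw [norm_mul, hnormw, Complex.norm_real, Real.norm_eq_abs, abs_of_pos (by linarith), norm_one]
          ring
  have hden : (a - 1) ^ 2 * (a - 1) ^ 2 ≤ ‖((a : ℂ) - 1) ^ 2 * (w - 1) ^ 2‖ := by
    rw [norm_mul, norm_pow, norm_pow, show ((a : ℂ) - 1) = (((a - 1 : ℝ)) : ℂ) by push_cast; ring,
      Complex.norm_real, Real.norm_eq_abs, abs_of_pos ha1]
    exact mul_le_mul_of_nonneg_left (pow_le_pow_left₀ ha1.le hw1_norm 2) (by positivity)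
  have hden0 : 0 < (a - 1) ^ 2 * (a - 1) ^ 2 := by positivity
  have hfrac : ‖(w - a) * (a * w - 1) / (((a : ℂ) - 1) ^ 2 * (w - 1) ^ 2)‖ ≤
      a * (|t| * Real.log p) * (a ^ 2 + 1) / ((a - 1) ^ 2 * (a - 1) ^ 2) := by
    rw [norm_div, norm_mul]
    calc ‖w - a‖ * ‖(a : ℂ) * w - 1‖ / ‖((a : ℂ) - 1) ^ 2 * (w - 1) ^ 2‖
        ≤ a * (|t| * Real.log p) * (a ^ 2 + 1) / ‖((a : ℂ) - 1) ^ 2 * (w - 1) ^ 2‖ := by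
          refine div_le_div_of_nonneg_right ?_ (norm_nonneg _)
          exact mul_le_mul hwa_norm haw_norm (norm_nonneg _) (by positivity)
      _ ≤ a * (|t| * Real.log p) * (a ^ 2 + 1) / ((a - 1) ^ 2 * (a - 1) ^ 2) :=
          div_le_div_of_nonneg_left (by positivity) hden0 hden
  -- `(a²+1)/(a-1)² ≤ 13`
  have h13 : (a ^ 2 + 1) / ((a - 1) ^ 2 * (a - 1) ^ 2) ≤ 13 / (a - 1) ^ 2 := by
    rw [div_le_div_iff₀ hden0 (by positivity)]
    have : a ^ 2 + 1 ≤ 13 * (a - 1) ^ 2 := by nlinarith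
    nlinarith [this, pow_pos ha1 2]
  have hreal : a / (a - 1) ^ 2 = (p : ℝ) ^ σ / ((p : ℝ) ^ σ - 1) ^ 2 := by rw [ha]
  calc Real.log p ^ 2 * ‖(w - a) * (a * w - 1) / (((a : ℂ) - 1) ^ 2 * (w - 1) ^ 2)‖
      ≤ Real.log p ^ 2 * (a * (|t| * Real.log p) * (a ^ 2 + 1) / ((a - 1) ^ 2 * (a - 1) ^ 2)) :=
        mul_le_mul_of_nonneg_left hfrac (sq_nonneg _)
    _ = Real.log p ^ 2 * (a * (|t| * Real.log p)) * ((a ^ 2 + 1) / ((a - 1) ^ 2 * (a - 1) ^ 2)) := by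
        ring
    _ ≤ Real.log p ^ 2 * (a * (|t| * Real.log y)) * (13 / (a - 1) ^ 2) := by
        refine mul_le_mul ?_ h13 (by positivity) (by positivity)
        refine mul_le_mul_of_nonneg_left ?_ (sq_nonneg _)
        exact mul_le_mul_of_nonneg_left (mul_le_mul_of_nonneg_left hlogpy (abs_nonneg t)) (by linarith)
    _ = 13 * |t| * Real.log y * (Real.log p ^ 2 * (a / (a - 1) ^ 2)) := by
        field_simp
    _ = 13 * |t| * Real.log y * (Real.log p ^ 2 * ((p : ℝ) ^ σ / ((p : ℝ) ^ σ - 1) ^ 2)) := by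
        rw [hreal]

end Literature.NumberTheory.Sieve

end
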